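import Summits.QuantumFields.YangMills.Theorems.LuscherReductionRunningReductionLatticeLinkKernel
import Summits.QuantumFields.YangMills.Theorems.FemtoTransferGapRungW1up
import HarnessLib

/-!
# Schur test and LARGE-FIELD suppression for the zero-flux transfer form of `SU(2)` on `(ℤ/L)³`, any `L`
# (sub-stub C1b of the fixed-lattice programme COARSE(L₀) — route `LuscherReduction`, crux RED stmt-QuantumFields-19978 KT-door 3b′ /
# crux `TwistedTraceScaling` stmt-QuantumFields-20203 S-BASE; card `pub/ym-fleet/ym-luscher-20007-p1/Lines-base-coarse-cut.md`)

With the factorisation `K_β = E_β · e^{−(β/2)(S(U)+S(V))}` and the row / column sums `∫ E_β(U,·) = ∫ E_β(·,V) = c_β^{|E|} = latCE L β` of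
`…RunningReductionLatticeLinkKernel.lean`:

* `qform_le_latCE_mul_l2` — **Schur test** `⟨ψ, K_β ψ⟩ ≤ c_β^{|E|} ‖ψ‖²` for every physical zero-flux `ψ` on the `L³` torus, hence
  `topValue_le_latCE : λ₀(β, L) ≤ c_β^{|E|}`;
* `qform_le_exp_neg_of_action_ge_lat` — **large-field suppression**: if the magnetic energy satisfies `S ≥ η` wherever `ψ ≠ 0`, then
  `⟨ψ, K_β ψ⟩ ≤ e^{−βη} · c_β^{|E|} · ‖ψ‖²`, and its `λ_b`-unit form `qform_le_exp_neg_of_action_ge_lambda_lat` (`S ≥ tλ_b³/2` costs `e^{−t}`);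
  both through the common integration step `qform_le_of_pointwise_lat` (pointwise bound `a·½(ψ(U)²+ψ(V)²)E_β` ⇒ `⟨ψ,K_βψ⟩ ≤ a c_β^{|E|}‖ψ‖²`).

These are the `L`-generic twins of `RungW1upSite` §C.3 and `LuscherReductionOneSiteLevelsLargeField` (one site).  In the COARSE programme they
dispose of the region `S(U) ≥ A·log β/β` once a polynomial lower bound `λ₀ ≥ c_β^{|E|} β^{−N}` is available (sub-stub C1c, not here).
HONEST FRAMING: the outermost onion layer only; no valley, no Born–Oppenheimer; femto rung R2b1; not a gap, not Clay.
-/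

set_option autoImplicit false

noncomputable section

open MeasureTheory Filter Topology Real
open scoped Matrix ComplexConjugate BigOperators
open Literature.MathematicalPhysics.QuantumFieldTheory
open Literature.MathematicalPhysics.QuantumLattice

namespace Summit.QuantumFields.YangMills.Theorems.FemtoTransferGap

variable {L : ℕ} [NeZero L]

/-! ## §1 Pointwise kernel bounds -/

/-- Pointwise AM–GM: `ψ(U) K_β(U,V) ψ(V) ≤ ½(ψ(U)² + ψ(V)²) · E_β(U,V)` (`β ≥ 0`). [folklore] -/
theorem kernel_pointwise_le_lat {β : ℝ} (hβ : 0 ≤ β) (ψ : GaugeConfig 3 L SU2 → ℝ) (p : GaugeConfig 3 L SU2 × GaugeConfig 3 L SU2) :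
    ψ p.1 * transferKernel su2Rep β p.1 p.2 * ψ p.2 ≤
      (1 / 2 : ℝ) * (latE L β p.1 p.2 * ψ p.1 ^ 2) + (1 / 2 : ℝ) * (latE L β p.1 p.2 * ψ p.2 ^ 2) := by
  have hK := transferKernel_pos su2Rep β p.1 p.2
  have hKE := transferKernel_le_latE hβ p.1 p.2
  have a1 : ψ p.1 * ψ p.2 * transferKernel su2Rep β p.1 p.2 ≤
      (1 / 2 : ℝ) * (ψ p.1 ^ 2 + ψ p.2 ^ 2) * transferKernel su2Rep β p.1 p.2 :=
    mul_le_mul_of_nonneg_right (by nlinarith [sq_nonneg (ψ p.1 - ψ p.2)]) hK.le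
  have a2 : (1 / 2 : ℝ) * (ψ p.1 ^ 2 + ψ p.2 ^ 2) * transferKernel su2Rep β p.1 p.2 ≤
      (1 / 2 : ℝ) * (ψ p.1 ^ 2 + ψ p.2 ^ 2) * latE L β p.1 p.2 :=
    mul_le_mul_of_nonneg_left hKE (by positivity)
  have e : ψ p.1 * transferKernel su2Rep β p.1 p.2 * ψ p.2 = ψ p.1 * ψ p.2 * transferKernel su2Rep β p.1 p.2 := by ring
  rw [e]; linarith

/-- Pointwise, with a magnetic floor: if `S ≥ η` wherever `ψ ≠ 0`, then
`ψ(U) K_β(U,V) ψ(V) ≤ e^{−βη} · ½(ψ(U)² + ψ(V)²) · E_β(U,V)` (`β ≥ 0`). [folklore] -/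
theorem kernel_pointwise_le_of_action_ge_lat {β : ℝ} (hβ : 0 ≤ β) {ψ : GaugeConfig 3 L SU2 → ℝ} {η : ℝ}
    (hη : ∀ U, ψ U ≠ 0 → η ≤ wilsonAction su2Rep U) (p : GaugeConfig 3 L SU2 × GaugeConfig 3 L SU2) :
    ψ p.1 * transferKernel su2Rep β p.1 p.2 * ψ p.2
      ≤ Real.exp (-(β * η)) * ((1 / 2 : ℝ) * (latE L β p.1 p.2 * ψ p.1 ^ 2) + (1 / 2 : ℝ) * (latE L β p.1 p.2 * ψ p.2 ^ 2)) := by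
  by_cases h0 : ψ p.1 = 0 ∨ ψ p.2 = 0
  · have hE := (latE_pos β p.1 p.2).le
    have hR : 0 ≤ Real.exp (-(β * η)) * ((1 / 2 : ℝ) * (latE L β p.1 p.2 * ψ p.1 ^ 2) + (1 / 2 : ℝ) * (latE L β p.1 p.2 * ψ p.2 ^ 2)) :=
      mul_nonneg (Real.exp_pos _).le (add_nonneg (mul_nonneg (by norm_num) (mul_nonneg hE (sq_nonneg _)))
        (mul_nonneg (by norm_num) (mul_nonneg hE (sq_nonneg _))))
    have hL : ψ p.1 * transferKernel su2Rep β p.1 p.2 * ψ p.2 = 0 := by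
      rcases h0 with h | h <;> rw [h] <;> ring
    rw [hL]
    exact hR
  · push Not at h0
    have hU := hη p.1 h0.1
    have hV := hη p.2 h0.2
    rw [transferKernel_eq_latE_mul]
    have hexp : Real.exp (-(β / 2) * (wilsonAction su2Rep p.1 + wilsonAction su2Rep p.2)) ≤ Real.exp (-(β * η)) :=
      Real.exp_le_exp.mpr (by nlinarith)
    have hE := (latE_pos β p.1 p.2).le
    have habs : |ψ p.1 * ψ p.2| ≤ (1 / 2 : ℝ) * (ψ p.1 ^ 2 + ψ p.2 ^ 2) := by
      rw [abs_le]; constructor <;> nlinarith [sq_nonneg (ψ p.1 + ψ p.2), sq_nonneg (ψ p.1 - ψ p.2)]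
    calc ψ p.1 * (latE L β p.1 p.2 * Real.exp (-(β / 2) * (wilsonAction su2Rep p.1 + wilsonAction su2Rep p.2))) * ψ p.2
        = (ψ p.1 * ψ p.2) * (latE L β p.1 p.2 * Real.exp (-(β / 2) * (wilsonAction su2Rep p.1 + wilsonAction su2Rep p.2))) := by ring
      _ ≤ |ψ p.1 * ψ p.2| * (latE L β p.1 p.2 * Real.exp (-(β / 2) * (wilsonAction su2Rep p.1 + wilsonAction su2Rep p.2))) :=
          mul_le_mul_of_nonneg_right (le_abs_self _) (mul_nonneg hE (Real.exp_pos _).le)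
      _ ≤ ((1 / 2 : ℝ) * (ψ p.1 ^ 2 + ψ p.2 ^ 2)) * (latE L β p.1 p.2 * Real.exp (-(β * η))) :=
          mul_le_mul habs (mul_le_mul_of_nonneg_left hexp hE) (mul_nonneg hE (Real.exp_pos _).le) (by positivity)
      _ = Real.exp (-(β * η)) * ((1 / 2 : ℝ) * (latE L β p.1 p.2 * ψ p.1 ^ 2) + (1 / 2 : ℝ) * (latE L β p.1 p.2 * ψ p.2 ^ 2)) := by
          ring

/-! ## §2 The Schur test and the large-field suppression -/

/-- The common integration step: if pointwise `ψ(U)Kψ(V) ≤ a · ½(ψ(U)² + ψ(V)²)·E_β` with a constant `a ≥ 0`, then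
`⟨ψ,K_βψ⟩ ≤ a · c_β^{|E|} · ‖ψ‖²`. [folklore] -/
theorem qform_le_of_pointwise_lat {β : ℝ} (hβ : 0 ≤ β) {ψ : GaugeConfig 3 L SU2 → ℝ} (hψ : IsPhys ψ) {a : ℝ}
    (hpt : ∀ p : GaugeConfig 3 L SU2 × GaugeConfig 3 L SU2, ψ p.1 * transferKernel su2Rep β p.1 p.2 * ψ p.2 ≤
      a * ((1 / 2 : ℝ) * (latE L β p.1 p.2 * ψ p.1 ^ 2) + (1 / 2 : ℝ) * (latE L β p.1 p.2 * ψ p.2 ^ 2))) :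
    qform su2Rep β ψ ψ ≤ a * latCE L β * l2 ψ ψ := by
  obtain ⟨C, hC⟩ := hψ.bounded
  have hm := hψ.measurable
  have hψ2m : Measurable fun U => ψ U ^ 2 := hm.pow_const 2
  have hψ2b : ∀ U, |ψ U ^ 2| ≤ C ^ 2 := fun U => by
    rw [abs_pow]; exact pow_le_pow_left₀ (abs_nonneg _) (hC U) 2
  have e1 := integral_prod_latE_mul_fst (L := L) β hψ2m hψ2b hβ
  have e2 := integral_prod_latE_mul_snd (L := L) β hψ2m hψ2b hβ
  have hG1 : Integrable (fun p : GaugeConfig 3 L SU2 × GaugeConfig 3 L SU2 => latE L β p.1 p.2 * ψ p.1 ^ 2)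
      ((configMeasure SU2 L).prod (configMeasure SU2 L)) := by
    refine integrable_latProd ((measurable_latE β).mul (hψ2m.comp measurable_fst))
      (C := Real.exp (2 * β) ^ Fintype.card (Edge 3 L) * C ^ 2) fun p => ?_
    rw [abs_mul]; exact mul_le_mul (abs_latE_le hβ _ _) (hψ2b _) (abs_nonneg _) (by positivity)
  have hG2 : Integrable (fun p : GaugeConfig 3 L SU2 × GaugeConfig 3 L SU2 => latE L β p.1 p.2 * ψ p.2 ^ 2)
      ((configMeasure SU2 L).prod (configMeasure SU2 L)) := by
    refine integrable_latProd ((measurable_latE β).mul (hψ2m.comp measurable_snd))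
      (C := Real.exp (2 * β) ^ Fintype.card (Edge 3 L) * C ^ 2) fun p => ?_
    rw [abs_mul]; exact mul_le_mul (abs_latE_le hβ _ _) (hψ2b _) (abs_nonneg _) (by positivity)
  have hG : Integrable (fun p : GaugeConfig 3 L SU2 × GaugeConfig 3 L SU2 =>
      a * ((1 / 2 : ℝ) * (latE L β p.1 p.2 * ψ p.1 ^ 2) + (1 / 2 : ℝ) * (latE L β p.1 p.2 * ψ p.2 ^ 2)))
      ((configMeasure SU2 L).prod (configMeasure SU2 L)) :=
    ((hG1.const_mul _).add (hG2.const_mul _)).const_mul _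
  have hF := integrable_latSandwich (measurable_transferKernel_lat β) (abs_transferKernel_le_lat hβ) hm hm hC hC
  have hl2 : l2 ψ ψ = ∫ U, ψ U ^ 2 ∂configMeasure SU2 L := by
    unfold l2; congr 1; funext U; ring
  rw [qform_eq_integral_latProd hβ hψ]
  calc ∫ p, ψ p.1 * transferKernel su2Rep β p.1 p.2 * ψ p.2 ∂(configMeasure SU2 L).prod (configMeasure SU2 L)
      ≤ ∫ p, a * ((1 / 2 : ℝ) * (latE L β p.1 p.2 * ψ p.1 ^ 2) + (1 / 2 : ℝ) * (latE L β p.1 p.2 * ψ p.2 ^ 2))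
          ∂(configMeasure SU2 L).prod (configMeasure SU2 L) := integral_mono hF hG hpt
    _ = a * ((1 / 2 : ℝ) * (latCE L β * ∫ U, ψ U ^ 2 ∂configMeasure SU2 L) +
          (1 / 2 : ℝ) * (latCE L β * ∫ U, ψ U ^ 2 ∂configMeasure SU2 L)) := by
        rw [integral_const_mul, integral_add (hG1.const_mul _) (hG2.const_mul _), integral_const_mul, integral_const_mul, e1, e2]
    _ = a * latCE L β * l2 ψ ψ := by rw [hl2]; ring

/-- ★ **Schur test on the `L³` torus**: `⟨ψ, K_β ψ⟩ ≤ c_β^{|E|} ‖ψ‖²` for every physical zero-flux `ψ` (`β ≥ 0`). [folklore] -/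
theorem qform_le_latCE_mul_l2 {β : ℝ} (hβ : 0 ≤ β) {ψ : GaugeConfig 3 L SU2 → ℝ} (hψ : IsPhys ψ) :
    qform su2Rep β ψ ψ ≤ latCE L β * l2 ψ ψ := by
  have h := qform_le_of_pointwise_lat hβ hψ (a := 1) (fun p => by rw [one_mul]; exact kernel_pointwise_le_lat hβ ψ p)
  rwa [one_mul] at h

/-- The Rayleigh quotient of the constant `1` lies in the unconstrained Rayleigh set of the `L³` torus. [folklore] -/
theorem one_mem_rayleighSet_lat (β : ℝ) :
    qform su2Rep β (L := L) (fun _ => (1 : ℝ)) (fun _ => 1) / l2 (G := SU2) (L := L) (fun _ => (1 : ℝ)) (fun _ => 1) ∈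
      rayleighSet su2Rep L β (fun _ => True) := by
  have hl2 : l2 (G := SU2) (L := L) (fun _ => (1 : ℝ)) (fun _ => 1) = 1 := by simp [l2]
  exact ⟨fun _ => 1, isPhys_const 1, trivial, by rw [hl2]; exact one_pos, rfl⟩

/-- ★ **Schur bound for the top value on the `L³` torus**: `λ₀(β, L) ≤ c_β^{|E|}` (`β ≥ 0`). [folklore] -/
theorem topValue_le_latCE {β : ℝ} (hβ : 0 ≤ β) : topValue su2Rep L β ≤ latCE L β := by
  unfold topValue
  refine csSup_le ⟨_, one_mem_rayleighSet_lat β⟩ ?_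
  rintro r ⟨ψ, hψ, -, hpos, rfl⟩
  rw [div_le_iff₀ hpos]
  exact qform_le_latCE_mul_l2 hβ hψ

/-- ★ **Large-field suppression on the `L³` torus.**  If the magnetic energy is at least `η` wherever the physical test function `ψ` does not
vanish, then `⟨ψ,K_βψ⟩ ≤ e^{−βη} · c_β^{|E|} · ‖ψ‖²` (`β ≥ 0`). [cite: Luscher1983, §2] [cite: Balaban1989LargeFieldII, p.355] -/
theorem qform_le_exp_neg_of_action_ge_lat {β : ℝ} (hβ : 0 ≤ β) {ψ : GaugeConfig 3 L SU2 → ℝ} (hψ : IsPhys ψ) {η : ℝ}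
    (hη : ∀ U, ψ U ≠ 0 → η ≤ wilsonAction su2Rep U) :
    qform su2Rep β ψ ψ ≤ Real.exp (-(β * η)) * latCE L β * l2 ψ ψ :=
  qform_le_of_pointwise_lat hβ hψ (kernel_pointwise_le_of_action_ge_lat hβ hη)

/-- **Large-field suppression in `λ_b` units** on the `L³` torus: with `β·λ_b(β)³ = 2` (`λ_b = bareLambda β = (2/β)^{1/3}`), a magnetic floor
`S ≥ t·λ_b³/2` wherever `ψ ≠ 0` costs the factor `e^{−t}`. [cite: Luscher1983, §2] -/
theorem qform_le_exp_neg_of_action_ge_lambda_lat {β : ℝ} (hβ : 0 < β) {ψ : GaugeConfig 3 L SU2 → ℝ} (hψ : IsPhys ψ) {t : ℝ}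
    (ht : ∀ U, ψ U ≠ 0 → t * bareLambda β ^ 3 / 2 ≤ wilsonAction su2Rep U) :
    qform su2Rep β ψ ψ ≤ Real.exp (-t) * latCE L β * l2 ψ ψ := by
  have h := qform_le_exp_neg_of_action_ge_lat hβ.le hψ ht
  have hcube := bareLambda_cube hβ
  have e : β * (t * bareLambda β ^ 3 / 2) = t := by
    calc β * (t * bareLambda β ^ 3 / 2) = t * (β * bareLambda β ^ 3) / 2 := by ring
      _ = t := by rw [hcube]; ring
  rwa [e] at h

end Summit.QuantumFields.YangMills.Theorems.FemtoTransferGap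

end
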